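import Summits.ValiantsHypothesis.ValiantsHypothesis.Theorems.BarrierLeverAnchoredDoorHitsLowerPairsGapOne

/-!
# Support item `AnchoredDoorHitsLowerPairs` (stmt-ValiantsHypothesis-22510), line `anchored-peeling`:
# THE GAP-ONE STEP WITH A FACE TARGET — peel `a ↦ (a | F)`, `F = {c} ∪ D` a column face with `|F| ≤ s` and `ℓ_F = ℓ_a + 1`

Helper file (`--supports stmt-ValiantsHypothesis-22510`; cell valiant-natproofs, rung V4, 𝒟-side door (c); registered line
`Cruxes/AnchoredDoorHitsLowerPairs/Lines/anchored_peeling.lean` v13, composition `Stmt.stub_uqFaceStep → Stmt.stub_uqFaceResidual → crux`; prover seat val-np-p1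
gen 19). This is the `m = 1` case of the REGISTERED face-target step `Stmt.stub_uqFaceStep` (file `…UQFaceStep`, p614490) as a kernel theorem. Closes NO item.

The face peel is a one-type DT stage with `y`-tail set `D` (`DTPeel.facePeelStage`; valid because `c ∉ D`): link rows become `(u i ∖ a | F)` with entries
`[F ⊆ w j] · [x^{u i∖a} y^{w j∖F}]𝔄`. Everything else is the proof of `symbolicDet_ne_zero_of_gapOne` (file `…GapOne`) with the private anchor `β₀ = ({b}, F)`
(in `anchors s h` exactly when `|F| ≤ s`) and the column predicate `q j := ¬ F ⊆ w j`.

* `DTPeel.facePeelStage`, `DTPeel.facePeelE`, `facePeelStage_valid/newU/newE`, `symbolicDet_ne_zero_of_facePeel_genDet` — the transfer.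
* `facePeelMatrix` and its three entry lemmas.
* `symbolicDet_ne_zero_of_gapOneFace` — the theorem.

WHAT THIS IS NOT: gaps `m ≥ 2` (up-sets with distinct roots) remain; nothing on crux stmt-ValiantsHypothesis-14610 or on `VP` versus `VNP`.
-/

set_option linter.dupNamespace false

open Matrix

namespace Summit.ValiantsHypothesis.ValiantsHypothesis.Theorems.BarrierLever.AnchoredPeeling

open Finset MvPolynomial
open Summit.ValiantsHypothesis.ValiantsHypothesis.Theorems.BarrierLever.BrickCalculus (pexpo pexpo_def pexpo_le_iff pexpo_sub)

noncomputable section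

/-! ## 1. The face-peel stage -/

namespace DTPeel

variable {h r : ℕ}

/-- The one-type DT stage peeling the `x`-vertex `a` onto the column face `{c} ∪ D`: type list `(∅, c, D)`. -/
def facePeelStage (h r : ℕ) (a c : Fin h) (D : Finset (Fin h)) : Stage h r where
  a := a
  J := 1
  B := fun _ => ∅
  c := fun _ => c
  D := fun _ => D
  cls := fun _ => 0

/-- The peeled `y`-shifts: rows that contained `a` are shifted by the face `{c} ∪ D`. -/
def facePeelE (a c : Fin h) (D : Finset (Fin h)) (u : Fin r → Finset (Fin h)) : Fin r → Finset (Fin h) :=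
  fun i => if a ∈ u i then insert c D else ∅

/-- The face-peel stage is valid on plain rows when `c ∉ D`. -/
theorem facePeelStage_valid (a c : Fin h) (D : Finset (Fin h)) (hcD : c ∉ D) (u : Fin r → Finset (Fin h)) :
    (facePeelStage h r a c D).Valid u (fun _ => ∅) := by
  refine ⟨fun x y _ => Subsingleton.elim (α := Fin 1) x y, fun _ => Finset.notMem_empty _, fun _ => hcD,
    fun _ _ => Finset.empty_subset _, fun _ _ j hj => absurd hj (Nat.not_lt_zero _), fun _ _ => Finset.disjoint_empty_left _⟩

/-- The stage's new `x`-sets are `onePeelU`. -/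
theorem facePeelStage_newU (a c : Fin h) (D : Finset (Fin h)) (u : Fin r → Finset (Fin h)) :
    (facePeelStage h r a c D).newU u = onePeelU a u := by
  funext i
  simp only [Stage.newU, facePeelStage, onePeelU, Finset.sdiff_empty]
  split_ifs with hi
  · rfl
  · exact (Finset.erase_eq_of_notMem hi).symm

/-- The stage's new `y`-shifts on plain rows are `facePeelE`. -/
theorem facePeelStage_newE (a c : Fin h) (D : Finset (Fin h)) (u : Fin r → Finset (Fin h)) :
    (facePeelStage h r a c D).newE u (fun _ => ∅) = facePeelE a c D u := by
  funext i
  simp only [Stage.newE, facePeelStage, facePeelE, Finset.empty_union]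

end DTPeel

variable {s h r : ℕ}

/-- One face peel on the `x`-side certifies the symbolic minor. -/
theorem symbolicDet_ne_zero_of_facePeel_genDet (hs : 1 ≤ s) (u w : Fin r → Finset (Fin h)) (a c : Fin h) (D : Finset (Fin h))
    (hcD : c ∉ D) (hne : DTPeel.genDet s h r (DTPeel.onePeelU a u) (DTPeel.facePeelE a c D u) w ≠ 0) : symbolicDet s h r u w ≠ 0 := by
  rw [← DTPeel.genDet_empty]
  refine (DTPeel.facePeelStage h r a c D).genDet_ne_zero hs u (fun _ => ∅) w (DTPeel.facePeelStage_valid a c D hcD u) ?_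
  rwa [DTPeel.facePeelStage_newU, DTPeel.facePeelStage_newE]

/-! ## 2. The face-peeled layout -/

/-- The face-peeled layout matrix at `(a, {c} ∪ D)`. -/
abbrev facePeelMatrix (s h r : ℕ) (u w : Fin r → Finset (Fin h)) (a c : Fin h) (D : Finset (Fin h)) :
    Matrix (Fin r) (Fin r) (MvPolynomial (Param h) ℂ) :=
  DTPeel.genMatrix s h r (DTPeel.onePeelU a u) (DTPeel.facePeelE a c D u) w

variable (u w : Fin r → Finset (Fin h)) (a c : Fin h) (D : Finset (Fin h))

/-- Link row, column not containing the face: zero. -/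
theorem facePeelMatrix_link_of_not_mem {i j : Fin r} (hi : a ∈ u i) (hj : ¬ (insert c D ⊆ w j)) :
    facePeelMatrix s h r u w a c D i j = 0 := by
  show DTPeel.genMatrix s h r _ _ w i j = 0
  rw [DTPeel.genMatrix, Matrix.of_apply, DTPeel.genEntry, DTPeel.facePeelE, if_pos hi, if_neg hj]

/-- Link row, column containing the face: the link-pair entry. -/
theorem facePeelMatrix_link_of_mem {i j : Fin r} (hi : a ∈ u i) (hj : insert c D ⊆ w j) :
    facePeelMatrix s h r u w a c D i j = coeff (pexpo ((u i).erase a) (w j \ insert c D)) (symbolicWitness s h) := by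
  show DTPeel.genMatrix s h r _ _ w i j = _
  rw [DTPeel.genMatrix, Matrix.of_apply, DTPeel.genEntry, DTPeel.facePeelE, if_pos hi, if_pos hj, DTPeel.onePeelU]

/-- Deletion row: the ordinary entry. -/
theorem facePeelMatrix_del {i : Fin r} (hi : a ∉ u i) (j : Fin r) :
    facePeelMatrix s h r u w a c D i j = coeff (pexpo (u i) (w j)) (symbolicWitness s h) := by
  show DTPeel.genMatrix s h r _ _ w i j = _
  rw [DTPeel.genMatrix, Matrix.of_apply, DTPeel.genEntry, DTPeel.facePeelE, if_neg hi, if_pos (Finset.empty_subset _), DTPeel.onePeelU,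
    Finset.erase_eq_of_notMem hi, Finset.sdiff_empty]

variable {u w a c D}

/-! ## 3. The face-target gap-one theorem -/

/-- **THE GAP-ONE STEP.** See the module docstring. Hypotheses: `u, w` injective; the column family contains `∅`; reindexings of the deletion-rows ×
`c`-free-columns block of the peeled layout as a tall `(n+1) × n` matrix and of the link-rows × `c`-columns block as a wide `n′ × (n′+1)` matrix; one nonzero
maximal minor of each (symbolic minors of the deletion pair and of the link pair). Conclusion: the symbolic minor of `(u, w)` is a nonzero polynomial. -/
theorem symbolicDet_ne_zero_of_gapOneFace (hs : 1 ≤ s) (hu : Function.Injective u) (hw : Function.Injective w)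
    (hcD : c ∉ D) (hF : (insert c D).card ≤ s) (hw0 : ∃ j, w j = ∅) {n n' : ℕ}
    (eA : {i : Fin r // ¬ (a ∈ u i)} ≃ Fin (n + 1)) (eQ : {j : Fin r // ¬ (insert c D ⊆ w j)} ≃ Fin n)
    (eP : {i : Fin r // a ∈ u i} ≃ Fin n') (eC : {j : Fin r // ¬ ¬ (insert c D ⊆ w j)} ≃ Fin (n' + 1))
    (x₀ : Fin (n + 1))
    (H1 : ((tallBlock (facePeelMatrix s h r u w a c D) (fun i => a ∈ u i) (fun j => ¬ (insert c D ⊆ w j)) eA eQ).submatrix x₀.succAbove id).det ≠ 0)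
    (y₀ : Fin (n' + 1))
    (H2 : ((wideBlock (facePeelMatrix s h r u w a c D) (fun i => a ∈ u i) (fun j => ¬ (insert c D ⊆ w j)) eP eC).submatrix id y₀.succAbove).det ≠ 0) :
    symbolicDet s h r u w ≠ 0 := by
  classical
  -- names
  let p : Fin r → Prop := fun i => a ∈ u i
  let F : Finset (Fin h) := insert c D
  have hcF : c ∈ F := Finset.mem_insert_self c D
  let q : Fin r → Prop := fun j => ¬ (F ⊆ w j)
  let G : Matrix (Fin r) (Fin r) (MvPolynomial (Param h) ℂ) := facePeelMatrix s h r u w a c D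
  let α : Fin r → MvPolynomial (Param h) ℂ := blockCofactorRow G p q eA eQ
  let β : Fin r → MvPolynomial (Param h) ℂ := blockCofactorCol G p q eP eC
  -- (A) the cofactor vectors are nonzero at the anchor coordinates
  have hα0 : α (eA.symm x₀).1 ≠ 0 := by
    show blockCofactorRow G p q eA eQ (eA.symm x₀).1 ≠ 0
    rw [blockCofactorRow_of_neg G p q eA eQ (eA.symm x₀).2]
    have e1 : eA ⟨(eA.symm x₀).1, (eA.symm x₀).2⟩ = x₀ := by simp
    rw [e1]
    exact (rowCofactor_ne_zero_iff _ _).mpr H1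
  have hβ0 : β (eC.symm y₀).1 ≠ 0 := by
    show blockCofactorCol G p q eP eC (eC.symm y₀).1 ≠ 0
    rw [blockCofactorCol_of_neg G p q eP eC (eC.symm y₀).2]
    have e1 : eC ⟨(eC.symm y₀).1, (eC.symm y₀).2⟩ = y₀ := by simp
    rw [e1, Matrix.colCofactor]
    exact mul_ne_zero (pow_ne_zero _ (by norm_num)) H2
  have hαne : α ≠ 0 := fun h0 => hα0 (by rw [h0]; rfl)
  have hβne : β ≠ 0 := fun h0 => hβ0 (by rw [h0]; rfl)
  -- (B) maximal support faces
  obtain ⟨i_A, hiA0, hiA⟩ := exists_maximal_support u hu α hαne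
  obtain ⟨j_B, hjB0, hjB⟩ := exists_maximal_support w hw β hβne
  have hiAp : a ∉ u i_A := fun hp => hiA0 (blockCofactorRow_of_pos G p q eA eQ hp)
  have hjBq : F ⊆ w j_B := by
    by_contra hq
    exact hjB0 (blockCofactorCol_of_pos G p q eP eC hq)
  -- (C) the row face A₀ = u i_A is nonempty
  have hA₀ne : (u i_A).Nonempty := by
    by_contra hempty
    rw [Finset.not_nonempty_iff_eq_empty] at hempty
    obtain ⟨j₀, hj₀⟩ := hw0
    have hq₀ : q j₀ := by
      show ¬ (F ⊆ w j₀)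
      rw [hj₀]
      exact fun hsub => Finset.notMem_empty c (hsub hcF)
    have hker := blockCofactorRow_vecMul_of_pos G p q eA eQ hq₀
    have hsupp : ∀ i, i ≠ i_A → α i = 0 := fun i hi => by
      by_contra hne
      exact hi (hiA i hne (by rw [hempty]; exact Finset.empty_subset _))
    have hsum : (α ᵥ* G) j₀ = α i_A * G i_A j₀ := by
      change ∑ i, α i * G i j₀ = _
      rw [Finset.sum_eq_single i_A (fun i _ hi => by rw [hsupp i hi, zero_mul]) (fun h' => (h' (Finset.mem_univ _)).elim)]
    have hG1 : G i_A j₀ = 1 := by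
      show facePeelMatrix s h r u w a c D i_A j₀ = 1
      rw [facePeelMatrix_del u w a c D hiAp, hempty, hj₀, pexpo_def, Finset.sum_empty, Finset.sum_empty, add_zero, ← constantCoeff_eq,
        constantCoeff_symbolicWitness]
    rw [hsum, hG1, mul_one] at hker
    exact hiA0 hker
  obtain ⟨b, hb⟩ := hA₀ne
  -- (D) the private anchor and its specialisation
  let β₀ : Finset (Fin h) × Finset (Fin h) := ({b}, F)
  have hβ₀ : β₀ ∈ anchors s h := by
    rw [anchors, Finset.mem_filter]
    refine ⟨Finset.mem_univ _, ?_⟩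
    have hFpos : 1 ≤ F.card := Finset.card_pos.mpr ⟨c, hcF⟩
    have hFle : F.card ≤ s := hF
    simp only [β₀, Finset.card_singleton]
    omega
  let P : Finset (Fin h) := (u i_A).erase b
  let Q : Finset (Fin h) := w j_B \ F
  have hP : P ⊆ univ \ β₀.1 := by
    intro x hx
    rw [Finset.mem_sdiff, Finset.mem_singleton]
    exact ⟨Finset.mem_univ _, (Finset.mem_erase.mp hx).1⟩
  have hQ : Q ⊆ univ \ β₀.2 := by
    intro x hx
    rw [Finset.mem_sdiff]
    exact ⟨Finset.mem_univ _, (Finset.mem_sdiff.mp hx).2⟩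
  have hAP : β₀.1 ∪ P = u i_A := by
    show {b} ∪ (u i_A).erase b = u i_A
    rw [← Finset.insert_eq, Finset.insert_erase hb]
  have hBQ : β₀.2 ∪ Q = w j_B := by
    show F ∪ (w j_B \ F) = w j_B
    exact Finset.union_sdiff_of_subset hjBq
  let N : ℕ := P.card + Q.card + 1
  let f := specHom β₀ P Q
  let G' : Matrix (Fin r) (Fin r) (Polynomial (MvPolynomial (Param h) ℂ)) := G.map f
  -- (E) entries of G': constants outside the deletion × c-columns block
  have hG'C : ∀ i j, ¬ (a ∉ u i ∧ F ⊆ w j) → G' i j = Polynomial.C (G i j) := by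
    intro i j hij
    show f (facePeelMatrix s h r u w a c D i j) = Polynomial.C (facePeelMatrix s h r u w a c D i j)
    by_cases hi : a ∈ u i
    · by_cases hj : F ⊆ w j
      · rw [facePeelMatrix_link_of_mem u w a c D hi hj]
        exact specHom_coeff_eq_C hβ₀ hP hQ _ _ (fun h2 => by
          have h3 : c ∈ w j \ insert c D := h2.2 hcF
          exact (Finset.mem_sdiff.mp h3).2 hcF)
      · rw [facePeelMatrix_link_of_not_mem u w a c D hi hj, map_zero, map_zero]
    · have hj : ¬ (F ⊆ w j) := fun hj => hij ⟨hi, hj⟩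
      rw [facePeelMatrix_del u w a c D hi j]
      exact specHom_coeff_eq_C hβ₀ hP hQ _ _ (fun h2 => hj h2.2)
  -- top coefficients of all entries of G'
  have hG'top : ∀ i j, (G' i j).coeff N =
      if (a ∉ u i ∧ F ⊆ w j) ∧ (u i_A ⊆ u i ∧ w j_B ⊆ w j) then restEntry s h β₀ (u i \ u i_A) (w j \ w j_B) else 0 := by
    intro i j
    by_cases hij : a ∉ u i ∧ F ⊆ w j
    · show (f (facePeelMatrix s h r u w a c D i j)).coeff N = _
      rw [facePeelMatrix_del u w a c D hij.1 j, coeff_specHom_coeff_top hβ₀ hP hQ, hAP, hBQ]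
      by_cases h2 : u i_A ⊆ u i ∧ w j_B ⊆ w j
      · rw [if_pos h2, if_pos ⟨hij, h2⟩]
      · rw [if_neg h2, if_neg (fun h3 => h2 h3.2)]
    · rw [hG'C i j hij, Polynomial.coeff_C, if_neg (Nat.succ_ne_zero _), if_neg (fun h3 => hij h3.1)]
  -- (F) the blocks of G' are the constant images of the blocks of G
  have htall : tallBlock G' p q eA eQ = (tallBlock G p q eA eQ).map Polynomial.C := by
    refine Matrix.ext (fun x y => ?_)
    show G' (eA.symm x).1 (eQ.symm y).1 = Polynomial.C (G (eA.symm x).1 (eQ.symm y).1)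
    exact hG'C _ _ (fun h2 => (eQ.symm y).2 h2.2)
  have hwide : wideBlock G' p q eP eC = (wideBlock G p q eP eC).map Polynomial.C := by
    refine Matrix.ext (fun x y => ?_)
    show G' (eP.symm x).1 (eC.symm y).1 = Polynomial.C (G (eP.symm x).1 (eC.symm y).1)
    exact hG'C _ _ (fun h2 => h2.1 (eP.symm x).2)
  have hαmap : blockCofactorRow G' p q eA eQ = fun i => Polynomial.C (α i) := by
    funext i
    by_cases hi : p i
    · rw [blockCofactorRow_of_pos G' p q eA eQ hi]
      show (0 : Polynomial _) = Polynomial.C (blockCofactorRow G p q eA eQ i)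
      rw [blockCofactorRow_of_pos G p q eA eQ hi, map_zero]
    · rw [blockCofactorRow_of_neg G' p q eA eQ hi, htall, rowCofactor_map]
      show _ = Polynomial.C (blockCofactorRow G p q eA eQ i)
      rw [blockCofactorRow_of_neg G p q eA eQ hi]
  have hβmap : blockCofactorCol G' p q eP eC = fun j => Polynomial.C (β j) := by
    funext j
    by_cases hj : q j
    · rw [blockCofactorCol_of_pos G' p q eP eC hj]
      show (0 : Polynomial _) = Polynomial.C (blockCofactorCol G p q eP eC j)
      rw [blockCofactorCol_of_pos G p q eP eC hj, map_zero]
    · rw [blockCofactorCol_of_neg G' p q eP eC hj, hwide, colCofactor_map]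
      show _ = Polynomial.C (blockCofactorCol G p q eP eC j)
      rw [blockCofactorCol_of_neg G p q eP eC hj]
  -- (G) det G' ≠ 0 by the kernel-line bridge
  have hdetG' : G'.det ≠ 0 := by
    refine det_ne_zero_of_minors G' p q eA eQ eP eC (fun i j hi hj => ?_) x₀ ?_ y₀ ?_ ?_
    · show f (facePeelMatrix s h r u w a c D i j) = 0
      rw [facePeelMatrix_link_of_not_mem u w a c D hi hj, map_zero]
    · rw [htall, Matrix.submatrix_map, ← RingHom.mapMatrix_apply, ← RingHom.map_det]
      exact fun h0 => H1 (Polynomial.C_eq_zero.mp h0)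
    · rw [hwide, Matrix.submatrix_map, ← RingHom.mapMatrix_apply, ← RingHom.map_det]
      exact fun h0 => H2 (Polynomial.C_eq_zero.mp h0)
    · rw [hαmap, hβmap, dotProduct_mulVec_eq_sum_sum]
      refine cross_top_ne_zero u w (u i_A) (w j_B) α β (fun i j => G' i j) N (fun i j hij => ?_) i_A hiA j_B hjB ?_
      · rw [hG'top, if_neg (fun h3 => hij h3.2)]
      · rw [hG'top, if_pos ⟨⟨hiAp, hjBq⟩, subset_rfl, subset_rfl⟩, Finset.sdiff_self, Finset.sdiff_self, restEntry_empty_empty,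
          mul_one]
        exact mul_ne_zero hiA0 hjB0
  -- (H) conclude
  have hdetG : G.det ≠ 0 := by
    intro h0
    apply hdetG'
    show (G.map f).det = 0
    rw [← RingHom.mapMatrix_apply, ← RingHom.map_det, h0, map_zero]
  exact symbolicDet_ne_zero_of_facePeel_genDet hs u w a c D hcD hdetG

end

end Summit.ValiantsHypothesis.ValiantsHypothesis.Theorems.BarrierLever.AnchoredPeeling
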